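import Summits.KontsevichZagierPeriods.KontsevichZagierPeriods.Theorems.LinRedNormalFormArrangementNormalFormStubRebaseSimplePosManyWedge

/-!
# Stub `stub_rebaseSimplePosMany`, part `rebaseSimplePosMany_product` (crux `ArrangementNormalForm`, line `janus-bands`) — `Blow`

The BLOW-UP of one fibre `i` of a product representation over a base of dimension `B + 1`,
PINCHED COAXIALLY on its letter (rule 2 with the non-affine substitution
`tᵢ = c(x', y) + σᵢ φ(x', y)`, spectators and base untouched, Jacobian `φ(x', y)`; the
`K`-generic version of `RebasePos.blowUp` and the `B`-generic version of `RebaseZero.blow`): if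
the bounds of the lettered fibre `i` are coaxial with its letter `c`, `Uᵢ − c = A (Vᵢ − Uᵢ)`
(so `Vᵢ − c = (A + 1)(Vᵢ − Uᵢ)`: the two bounding hyperplanes and the letter hyperplane share an
axis), then with `φ = Vᵢ − Uᵢ > 0` the fibre becomes the CONSTANT interval `(A, A + 1)` with the
letter `0` (`RebaseMany.blow`), i.e. it is in format, and the representation is good as soon as
the continuation hypothesis holds (`RebaseMany.good_coaxial`). The calculus of the substitution:
`RebaseMany.fibBlow` (the map), `fibBlowL` (its derivative, a rank-one perturbation of the
identity), `det_fibBlowL` (`= φ`, by `RebaseZero.det_id_add_smulRight`). Registered: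
`rebaseSimplePosMany_det_fibBlowL`.

References: M. Kontsevich, D. Zagier, *Periods* (2001), §1.2, rule (2).
-/

noncomputable section

open Set MeasureTheory MvPolynomial
open Literature.NumberTheory.Transcendental Literature.ModelTheory.ExponentialFields

namespace Summit.KontsevichZagierPeriods.ArrangementNormalForm.JanusBands

namespace RebaseMany

open SeparatePos RebasePos

variable {B K : ℕ}

/-! ### The blow-up map -/

/-- The blow-up substitution of the fibre `i`: `tᵢ = c(x', y) + σᵢ φ(x', y)`, the other
coordinates fixed. [folklore] -/
def fibBlow (i : Fin K) (c φ : Cf B) (w : Fin (B + 1 + K) → ℝ) : Fin (B + 1 + K) → ℝ :=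
  Function.update w (Fin.natAdd (B + 1) i) (affF B K c w + w (Fin.natAdd (B + 1) i) * affF B K φ w)

/-- The linear part of an atom. [folklore] -/
def affL (K : ℕ) (c : Cf B) : (Fin (B + 1 + K) → ℝ) →L[ℝ] ℝ :=
  ∑ j : Fin (B + 1), (c.1 j : ℝ) • ContinuousLinearMap.proj (R := ℝ) (φ := fun _ : Fin (B + 1 + K) => ℝ) (Fin.castAdd K j)

/-- The derivative of `fibBlow` at `w`: the identity plus a rank-one map onto the `tᵢ`-axis.
[folklore] -/
def fibBlowL (i : Fin K) (c φ : Cf B) (w : Fin (B + 1 + K) → ℝ) :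
    (Fin (B + 1 + K) → ℝ) →L[ℝ] (Fin (B + 1 + K) → ℝ) :=
  ContinuousLinearMap.id ℝ _ + ContinuousLinearMap.smulRight
    (affL K c + (w (Fin.natAdd (B + 1) i) • affL K φ +
      affF B K φ w • ContinuousLinearMap.proj (R := ℝ) (φ := fun _ : Fin (B + 1 + K) => ℝ) (Fin.natAdd (B + 1) i)) -
      ContinuousLinearMap.proj (R := ℝ) (φ := fun _ : Fin (B + 1 + K) => ℝ) (Fin.natAdd (B + 1) i))
    (Pi.single (Fin.natAdd (B + 1) i) (1 : ℝ) : Fin (B + 1 + K) → ℝ)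

/-- `fibBlow` on the moved coordinate. [folklore] -/
@[simp] theorem fibBlow_self (i : Fin K) (c φ : Cf B) (w : Fin (B + 1 + K) → ℝ) :
    fibBlow i c φ w (Fin.natAdd (B + 1) i) = affF B K c w + w (Fin.natAdd (B + 1) i) * affF B K φ w := by
  rw [fibBlow, Function.update_self]

/-- `fibBlow` fixes the other coordinates. [folklore] -/
theorem fibBlow_of_ne (i : Fin K) (c φ : Cf B) (w : Fin (B + 1 + K) → ℝ) {l : Fin (B + 1 + K)}
    (hl : l ≠ Fin.natAdd (B + 1) i) : fibBlow i c φ w l = w l := by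
  rw [fibBlow, Function.update_of_ne hl]

/-- `fibBlow` fixes the base coordinates. [folklore] -/
@[simp] theorem fibBlow_base (i : Fin K) (c φ : Cf B) (w : Fin (B + 1 + K) → ℝ) (j : Fin (B + 1)) :
    fibBlow i c φ w (Fin.castAdd K j) = w (Fin.castAdd K j) :=
  fibBlow_of_ne i c φ w (castAdd_ne_natAdd' j i)

/-- `fibBlow` fixes the spectator fibres. [folklore] -/
theorem fibBlow_fib_of_ne (i : Fin K) (c φ : Cf B) (w : Fin (B + 1 + K) → ℝ) {j : Fin K} (hj : j ≠ i) :
    fibBlow i c φ w (Fin.natAdd (B + 1) j) = w (Fin.natAdd (B + 1) j) :=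
  fibBlow_of_ne i c φ w (natAdd_injective'.ne hj)

/-- Atoms are unchanged by `fibBlow`. [folklore] -/
@[simp] theorem affF_fibBlow (i : Fin K) (c φ d : Cf B) (w : Fin (B + 1 + K) → ℝ) :
    affF B K d (fibBlow i c φ w) = affF B K d w :=
  affF_congr d fun j => fibBlow_base i c φ w j

/-- `fibBlow` as a translate along the `tᵢ`-axis. [folklore] -/
theorem fibBlow_eq (i : Fin K) (c φ : Cf B) (w : Fin (B + 1 + K) → ℝ) :
    fibBlow i c φ w = w + (affF B K c w + w (Fin.natAdd (B + 1) i) * affF B K φ w -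
      w (Fin.natAdd (B + 1) i)) • (Pi.single (Fin.natAdd (B + 1) i) (1 : ℝ) : Fin (B + 1 + K) → ℝ) := by
  funext l
  by_cases hl : l = Fin.natAdd (B + 1) i
  · subst hl
    simp [fibBlow_self]
  · rw [fibBlow_of_ne i c φ w hl]
    simp [Pi.single_eq_of_ne hl]

/-- The value of the linear part of an atom. [folklore] -/
theorem affL_apply (c : Cf B) (v : Fin (B + 1 + K) → ℝ) :
    affL K c v = ∑ j : Fin (B + 1), (c.1 j : ℝ) * v (Fin.castAdd K j) := by
  simp [affL]

/-- The linear part of an atom kills the `tᵢ`-axis. [folklore] -/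
@[simp] theorem affL_single (c : Cf B) (i : Fin K) :
    affL K c (Pi.single (Fin.natAdd (B + 1) i) (1 : ℝ) : Fin (B + 1 + K) → ℝ) = 0 := by
  rw [affL_apply]
  exact Finset.sum_eq_zero fun j _ => by rw [Pi.single_eq_of_ne (castAdd_ne_natAdd' j i), mul_zero]

/-- The derivative of an atom. [folklore] -/
theorem hasFDerivAt_affF (d : Cf B) (w : Fin (B + 1 + K) → ℝ) :
    HasFDerivAt (fun w : Fin (B + 1 + K) → ℝ => affF B K d w) (affL K d) w := by
  unfold affF affL
  exact (HasFDerivAt.fun_sum fun j _ =>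
    (hasFDerivAt_apply (Fin.castAdd K j) w).const_mul (d.1 j : ℝ)).add_const _

/-- The derivative of `fibBlow`. [folklore] -/
theorem hasFDerivAt_fibBlow (i : Fin K) (c φ : Cf B) (w : Fin (B + 1 + K) → ℝ) :
    HasFDerivAt (fibBlow i c φ) (fibBlowL i c φ w) w := by
  have hfun : fibBlow i c φ = fun w => w + (affF B K c w + w (Fin.natAdd (B + 1) i) * affF B K φ w -
      w (Fin.natAdd (B + 1) i)) • (Pi.single (Fin.natAdd (B + 1) i) (1 : ℝ) : Fin (B + 1 + K) → ℝ) :=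
    funext (fibBlow_eq i c φ)
  rw [hfun]
  have ht : HasFDerivAt (fun w : Fin (B + 1 + K) → ℝ => w (Fin.natAdd (B + 1) i))
      (ContinuousLinearMap.proj (R := ℝ) (φ := fun _ : Fin (B + 1 + K) => ℝ) (Fin.natAdd (B + 1) i)) w :=
    hasFDerivAt_apply _ w
  have hφ : HasFDerivAt (fun w : Fin (B + 1 + K) → ℝ => affF B K c w + w (Fin.natAdd (B + 1) i) * affF B K φ w -
      w (Fin.natAdd (B + 1) i)) (affL K c + (w (Fin.natAdd (B + 1) i) • affL K φ +
      affF B K φ w • ContinuousLinearMap.proj (R := ℝ) (φ := fun _ : Fin (B + 1 + K) => ℝ) (Fin.natAdd (B + 1) i)) -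
      ContinuousLinearMap.proj (R := ℝ) (φ := fun _ : Fin (B + 1 + K) => ℝ) (Fin.natAdd (B + 1) i)) w :=
    ((hasFDerivAt_affF c w).add (ht.mul (hasFDerivAt_affF φ w))).sub ht
  exact (hasFDerivAt_id w).add (hφ.smul_const _)

/-- **The Jacobian determinant of the blow-up is `φ(x', y)`.** [folklore] -/
theorem det_fibBlowL (i : Fin K) (c φ : Cf B) (w : Fin (B + 1 + K) → ℝ) :
    (fibBlowL i c φ w).det = affF B K φ w := by
  rw [fibBlowL, RebaseZero.det_id_add_smulRight]
  simp

/-- `fibBlow` is injective where `φ ≠ 0`. [folklore] -/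
theorem fibBlow_injOn (i : Fin K) (c φ : Cf B) {R : Set (Fin (B + 1 + K) → ℝ)}
    (hR : ∀ w ∈ R, affF B K φ w ≠ 0) : InjOn (fibBlow i c φ) R := by
  intro w hw w' _ h
  have hne : ∀ l, l ≠ Fin.natAdd (B + 1) i → w l = w' l := fun l hl => by
    rw [← fibBlow_of_ne i c φ w hl, h, fibBlow_of_ne i c φ w' hl]
  have hc' : affF B K c w' = affF B K c w := affF_congr c fun j => (hne _ (castAdd_ne_natAdd' j i)).symm
  have hφ' : affF B K φ w' = affF B K φ w := affF_congr φ fun j => (hne _ (castAdd_ne_natAdd' j i)).symm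
  have ht := congrFun h (Fin.natAdd (B + 1) i)
  rw [fibBlow_self, fibBlow_self, hc', hφ'] at ht
  have ht' : w (Fin.natAdd (B + 1) i) = w' (Fin.natAdd (B + 1) i) :=
    mul_right_cancel₀ (hR w hw) (by linarith)
  funext l
  by_cases hl : l = Fin.natAdd (B + 1) i
  · rw [hl]; exact ht'
  · exact hne l hl

/-- `fibBlow` is a semialgebraic map. [folklore] -/
theorem isSemialgebraicMapOn_fibBlow (i : Fin K) (c φ : Cf B) {R : Set (Fin (B + 1 + K) → ℝ)}
    (hR : IsSemialgebraic ℚ R) : IsSemialgebraicMapOn ℚ R (fibBlow i c φ) := by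
  refine (isSemialgebraicMapOn_aeval hR (Function.update (fun l => X l) (Fin.natAdd (B + 1) i)
    (affFPoly c + X (Fin.natAdd (B + 1) i) * affFPoly φ))).congr fun w _ => ?_
  funext l
  dsimp only
  by_cases hl : l = Fin.natAdd (B + 1) i
  · subst hl
    rw [Function.update_self, fibBlow_self]
    simp [aeval_affFPoly]
  · rw [Function.update_of_ne hl, fibBlow_of_ne i c φ w hl]
    simp

/-! ### The blow-up move -/

/-- **Blow-up of a fibre pinched coaxially on its letter** (rule 2 with
`tᵢ = c + σᵢ (Vᵢ − Uᵢ)`, Jacobian `Vᵢ − Uᵢ > 0`): if the bounds of the lettered fibre `i` satisfy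
`Uᵢ − c = A (Vᵢ − Uᵢ)` as atoms, the fibre `i` becomes the constant interval `(A, A + 1)` with the
letter `0`, the numerator and the spectators are untouched, and the two representations differ by
a relation. -/
theorem blow {s : KZ.IntegralRep (B + 1 + K)} {m' : ℕ} {M : Fin m' → Cf B} {U V : Fin K → Cf B}
    {T : BData B} {p : MvPolynomial (Fin B) ℚ} {a : Fin K → Option (Cf B)} (h : IsProd s M U V T p a)
    (i : Fin K) (c : Cf B) (ha : a i = some c) (A : ℚ) (hA : U i - c = A • (V i - U i))
    (huv : ∀ z ∈ cell K M, affF B K (U i) z < affF B K (V i) z) :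
    ∃ s' : KZ.IntegralRep (B + 1 + K),
      IsProd s' M (Function.update U i (cst B A)) (Function.update V i (cst B (A + 1))) T p
        (Function.update a i (some 0)) ∧
      KZ.of s - KZ.of s' ∈ KZ.relations := by
  set φ : Cf B := V i - U i with hφdef
  set U' := Function.update U i (cst B A) with hU'
  set V' := Function.update V i (cst B (A + 1)) with hV'
  set a' : Fin K → Option (Cf B) := Function.update a i (some 0) with ha'
  set R := pDom M U' V' with hRdef
  set f' := glitB T p a' with hf'
  set F := glitB T p (Function.update a i none) with hF
  set Ψ := fibBlow i c φ with hΨ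
  -- affine identities
  have hφpos : ∀ z ∈ cell K M, 0 < affF B K φ z := fun z hz => by
    rw [hφdef, affF_sub]; linarith [huv z hz]
  have huc : ∀ z : Fin (B + 1 + K) → ℝ, affF B K (U i) z - affF B K c z = (A : ℝ) * affF B K φ z :=
    fun z => by
      have key := congrArg (fun q => affF B K q z) hA
      simp only [affF_sub, affF_smul] at key
      exact key
  have hvc : ∀ z : Fin (B + 1 + K) → ℝ, affF B K (V i) z - affF B K c z = ((A : ℝ) + 1) * affF B K φ z :=
    fun z => by
      have h1 := huc z
      rw [hφdef, affF_sub] at h1 ⊢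
      linarith
  -- membership
  have keyR : ∀ w, w ∈ R ↔ w ∈ cell K M ∧ ((A : ℝ) < w (Fin.natAdd (B + 1) i) ∧
      w (Fin.natAdd (B + 1) i) < (A : ℝ) + 1) ∧ ∀ j, j ≠ i →
      affF B K (U j) w < w (Fin.natAdd (B + 1) j) ∧ w (Fin.natAdd (B + 1) j) < affF B K (V j) w := by
    intro w
    rw [hRdef, mem_pDom_fibre M _ _ i]
    simp only [hU', hV', Function.update_self, affF_cst, Rat.cast_add, Rat.cast_one]
    refine and_congr_right fun _ => and_congr_right fun _ => ?_
    refine forall_congr' fun j => forall_congr' fun hj => ?_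
    rw [Function.update_of_ne hj, Function.update_of_ne hj]
  have keyD : ∀ z, z ∈ s.domain ↔ z ∈ cell K M ∧ (affF B K (U i) z < z (Fin.natAdd (B + 1) i) ∧
      z (Fin.natAdd (B + 1) i) < affF B K (V i) z) ∧ ∀ j, j ≠ i →
      affF B K (U j) z < z (Fin.natAdd (B + 1) j) ∧ z (Fin.natAdd (B + 1) j) < affF B K (V j) z :=
    fun z => by rw [h.dom, mem_pDom_fibre M U V i]
  have hmem : ∀ w, w ∈ R ↔ Ψ w ∈ s.domain := fun w => by
    rw [keyR, keyD, hΨ, mem_cell_congr M (fun j => fibBlow_base i c φ w j)]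
    simp only [affF_fibBlow, fibBlow_self]
    refine and_congr_right fun hcell => and_congr ?_ ?_
    · have hp := hφpos w hcell
      have h1 := huc w
      have h2 := hvc w
      constructor
      · rintro ⟨h3, h4⟩; constructor <;> nlinarith
      · rintro ⟨h3, h4⟩
        constructor
        · nlinarith
        · nlinarith
    · refine forall_congr' fun j => forall_congr' fun hj => ?_
      rw [fibBlow_fib_of_ne i c φ w hj]
  -- the inverse map
  set Φ : (Fin (B + 1 + K) → ℝ) → (Fin (B + 1 + K) → ℝ) := fun z =>
    Function.update z (Fin.natAdd (B + 1) i) ((z (Fin.natAdd (B + 1) i) - affF B K c z) / affF B K φ z) with hΦ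
  have hΨΦ : ∀ z ∈ s.domain, Ψ (Φ z) = z := fun z hz => by
    have hp : affF B K φ z ≠ 0 := (hφpos z ((keyD z).1 hz).1).ne'
    funext l
    by_cases hl : l = Fin.natAdd (B + 1) i
    · subst hl
      rw [hΨ, fibBlow_self]
      simp only [hΦ, affF_update, Function.update_self]
      field_simp
      ring
    · rw [hΨ, fibBlow_of_ne i c φ _ hl]
      simp only [hΦ, Function.update_of_ne hl]
  have himg : Ψ '' R = s.domain := by
    ext z
    constructor
    · rintro ⟨w, hw, rfl⟩; exact (hmem w).1 hw
    · intro hz; exact ⟨Φ z, (hmem _).2 (by rw [hΨΦ z hz]; exact hz), hΨΦ z hz⟩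
  -- the new integrand is the old one after substitution times the Jacobian
  have hFΨ : ∀ w, F (Ψ w) = F w := fun w =>
    glit_congr T p _ (fun j' => fibBlow_base i c φ w j') fun j hj =>
      fibBlow_fib_of_ne i c φ w fun hji => hj (by subst hji; simp)
  have hint : ∀ w ∈ R, f' w = s.integrand (Ψ w) * |(fibBlowL i c φ w).det| := by
    intro w hw
    have hcell : w ∈ cell K M := ((keyR w).1 hw).1
    have hp := hφpos w hcell
    rw [det_fibBlowL, h.int ((hmem w).1 hw), abs_of_pos hp, hf',
      glit_split T p a' i 0 (by simp [ha']) w, glit_split T p a i c ha (Ψ w)]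
    rw [show Function.update a' i none = Function.update a i none by rw [ha', Function.update_idem]]
    rw [← hF, hFΨ, hΨ, fibBlow_self, affF_fibBlow, affF_zero, sub_zero, add_sub_cancel_left]
    rcases eq_or_ne (w (Fin.natAdd (B + 1) i)) 0 with h0 | h0
    · simp [h0]
    · field_simp
  obtain ⟨s', hs'd, hs'i, hrel⟩ := RebaseZero.cov_pull s (isSemialgebraic_pDom M U' V') Ψ
    (fibBlowL i c φ) (isSemialgebraicMapOn_fibBlow i c φ (isSemialgebraic_pDom _ _ _))
    (fun w _ => (hasFDerivAt_fibBlow i c φ w).hasFDerivWithinAt)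
    (fibBlow_injOn i c φ fun w hw => (hφpos w ((keyR w).1 hw).1).ne') himg f'
    (isSemialgebraicFunOn_glit (isSemialgebraic_pDom _ _ _) _ _ _ _ _ _ _ _) hint
  obtain ⟨Rb, hRb⟩ := h.cbd
  exact ⟨s', ⟨hs'd, fun z _ => by rw [hs'i], h.adm, Rb, hRb⟩, hrel⟩

/-- **A coaxial pinch is good** (given the continuation hypothesis): after the blow-up the fibre
`i` is in format (letter `0`, constant bounds `A < σᵢ < A + 1`) and the spectators are unchanged. -/
theorem good_coaxial {s : KZ.IntegralRep (B + 1 + K)} {m' : ℕ} {M : Fin m' → Cf B} {U V : Fin K → Cf B}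
    {T : BData B} {p : MvPolynomial (Fin B) ℚ} {a : Fin K → Option (Cf B)} (h : IsProd s M U V T p a)
    (i : Fin K) (c : Cf B) (ha : a i = some c) (hP : HPc T i M U V a) (A : ℚ)
    (hA : U i - c = A • (V i - U i)) (huv : ∀ z ∈ cell K M, affF B K (U i) z < affF B K (V i) z) :
    Good B K (KZ.of s) := by
  obtain ⟨s', h', hrel⟩ := blow h i c ha A hA huv
  refine good_of_sub_mem hrel (hP.apply h' Subset.rfl ⟨fun c' hc' => ?_, Or.inl ?_, Or.inl ?_⟩
    (same_update i U V a _ _ _))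
  · simp only [Function.update_self, Option.some.injEq] at hc'
    rw [← hc']; rfl
  · rw [Function.update_self]; rfl
  · rw [Function.update_self]; rfl

end RebaseMany

/-- Registered support goal of this file: the Jacobian determinant of the single-fibre blow-up
`tᵢ = c(x', y) + σᵢ φ(x', y)` is `φ(x', y)`. -/
theorem rebaseSimplePosMany_det_fibBlowL (B K : ℕ) (i : Fin K) (c φ : (Fin (B + 1) → ℚ) × ℚ) (w : Fin (B + 1 + K) → ℝ) : (RebaseMany.fibBlowL i c φ w).det = SeparatePos.affF B K φ w :=
  RebaseMany.det_fibBlowL i c φ w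

end Summit.KontsevichZagierPeriods.ArrangementNormalForm.JanusBands
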